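import Summits.AtomisticToContinuum.FouriersLaw.Theses.PhononMeanFreePath
import Summits.AtomisticToContinuum.FouriersLaw.Theorems.PhononMeanFreePathDefs
import Summits.AtomisticToContinuum.FouriersLaw.Theorems.PhononMeanFreePathCoherentDephasingWeakCouplingIntegrability

/-!
# Line `optical-theorem-memory` (sectorial inverse mobility + Combes–Thomas) — crux
# `PhononMeanFreePath.CoherentDephasing` (stmt-AtomisticToContinuum-11810)

Strategist's ALTERNATIVE skeleton (crux-strategist `cstrat-stmt-AtomisticToContinuum-11810-s1`, 2026-08-17), registered
NEXT TO the live line `Lines/Sketch.lean` (coherent-field Beer–Lambert, lead c3, one open stub `stub_blockLossBound`);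
it does not touch that skeleton. Idea card: `Cruxes/CoherentDephasing/Ideas/optical-theorem-memory.md` (crux-ideate k=1,
triage r1: pass ×2, "not a costume"; the lead's first fallback in `PICKED.md`). No crux-plan unit was ever run for it.

THE CRUX. `P = pinnedChain ω₂ lam β γ` (all `> 0`), `T > 0`, `r_N(t) = ⟨p₀, K_t p_N⟩_{μ_T} = pairCorr … N t` on the
`(N+1)`-site chain: `(∀ N, r_N² ∈ L¹(0,∞)) ∧ N ∫₀^∞ r_N² → 0`.

THE LINE (frequency domain). Let `M_{xy}(t) = ⟨p_x, K_t p_y⟩_{μ_T}` be the momentum response matrix (`respMat`;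
`M_{0N} = r_N` by `rfl`) and `Ĝ_N(ω) = ∫₀^∞ e^{-iωt} M(t) dt ∈ M_{N+1}(ℂ)` its causal Fourier transform (`respHat`, the
boundary value of the mobility matrix on the imaginary axis; absolutely convergent at fixed `N`). Mori's identity
(exact, because `p₀, p_N` are one-particle coordinates and the OU bath operator preserves the one-particle sector) reads
`Ĝ_N(ω) = T · (iω + Φ_eff/(iω) + Γ + K̂(iω))⁻¹`, `Φ_eff = T·Cov_μ(q)⁻¹` (dressed springs, `≥ ω₂`, exp-local), `Γ = γ(E₀₀ + E_NN)`,
`K̂` = Laplace transform of the orthogonal-dynamics autocorrelation of the fluctuating anharmonic forces — ACCRETIVE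
(`Re K̂ ≥ 0`) by passivity of the equilibrium chain, `≡ 0` iff `lam = β = 0`. The composition proved below is

  Parseval with a high-frequency remainder (STUB P, fixed `N`)      `∫₀^∞ r_N² ≤ ∫_{|ω|≤Ω} |Ĝ_{0N}|² + Ω⁻² ∫₀^∞ ṙ_N²`
  + `N`-uniform energy of `ṙ_N = kickResp (L p_N)` (STUB H, absolute; landed Landauer inequality)  `∫₀^∞ ṙ_N² ≤ C₁`
  + SECTORIAL MARGIN + QUASI-LOCALITY of the rescaled inverse mobility `D = min(|ω|,1)·T·Ĝ_N(ω)⁻¹` (STUB M, THE stub)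
  + abstract Combes–Thomas for such matrices (STUB CT, linear algebra)   `|(D⁻¹)_{0N}| ≤ A e^{-θ' N}`
  ⟹ with `Ω = N`:  `N ∫₀^∞ r_N² ≤ 2T²A² · N² e^{-2θ'N} + C₁/N → 0`, i.e. `CoherentDephasing` BY NAME (`CoherentDephasing_of`).

WHY THE RESCALING `min(|ω|,1)`: `Φ_eff/(iω)` blows up at `ω → 0` in both the margin and the off-diagonal bound; their RATIO is
what Combes–Thomas uses, and multiplying `D_Mori` by `min(|ω|,1)` makes both constants uniform in `ω ∈ ℝ` (small `ω`: the
reactance `Φ_eff ≥ ω₂` gives the margin; large `ω`: inertia `iω`; dressed band: ABSORPTION `Re K̂ ≥ κ` — the optical theorem;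
gap: reactance `(Φ_eff − ω²)/ω`). At `ω = 0`, `Ĝ_N(0) = ∫₀^∞ M = 0` (sum rule) and the factorisation holds trivially.

HOW IT DIFFERS FROM `Sketch` AT THE STUCK STEP. Sketch's open stub is a RELATIVE time-domain inequality between two quadratic
functionals of the response field (`κ Σ_block E_x ≤ Σ_block s'_x`) whose right side `s_x = lam ∫ m_x c_x + …` is an indefinite
product of two projections with no sitewise sign structure (lead's BlockLawAnalysis §1/§3: positivity of the Mori kernel is
GLOBAL, Sz.-Nagy). Here the `N`-uniform input is asked of ONE accretive analytic matrix function: `Re K̂(iω) ≥ 0` is structural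
(passivity), the stub upgrades it to `≥ κ` on the dressed band uniformly in `N` (its `O(lam²)` germ is the explicit, positive
phonon-Boltzmann collision operator, Lukkarinen2016 §2.2/§3.3, AokiLukkarinenSpohn2006 §3), and Herglotz/Nevanlinna structure
(`Re K̂` harmonic in `z`, Poisson representation of the boundary measure) is available; spatial decay is then AUTOMATIC
(Combes–Thomas) instead of being telescoped bond by bond. Same physics (bulk absorption ⇒ extinction; triage: "three norms on
the same input"), different object and a different toolbox; the honest census (`STRATEGY-CENSUS.md`) records that STUB M carries
the same open-problem content (finite thermal phonon lifetime at fixed coupling beyond kinetic times) in `L^∞`-in-frequency form.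

STUBS (4; sorries only here): P `stub_parsevalWindow` (fixed `N`; tree Plancherel `Literature.Analysis.FunctionSpaces.PlancherelL1L2`
+ polynomial Dynkin `…StrictAbsorptionPolyDynkin.sa_polyDynkin` + `r_N(0) = ⟨p₀p_N⟩_{μ_T} = 0`; M/L) · H `stub_derivativeLandauer`
(`N`-uniform absolute; `KickDissipation.kickResp_sq_integral_le` with `g = L p_N` + uniform Gibbs moments; M) · M
`stub_moriSectorialMargin` (XL, load-bearing; = card's AccretivityMargin ∧ MemoryLocality ∧ HighFrequencyBound ∧ exp-locality of
`Φ_eff` (the last is Brascamp–Lieb/M-matrix monotonicity + Jaffard, provable) as ONE statement, per triage-1's sharpen) · CT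
`stub_combesThomas` (abstract, size-free constants `A = 2/κ`, `θ' = θ'(κ,θ,C)`; M/L).

Disproof.lean (cdisprove v3) honoured: §3 anharmonicity is used exactly in STUB M (at `lam = β = 0`, `K̂ ≡ 0`, no margin in the
band: RLL transmission, `HarmonicCoherentPersistence`); §4/§8 nothing `T`-uniform (`κ, θ, C, N₀` depend on the parameter point;
by the scaling normal form the line may be run at `T = 1`); §6 the sum rule `Ĝ(0) = 0` is consistent with the factorisation;
§7 kill switch 2 (a `c/N` floor from a transparency window) is exactly a zero of the margin inside the band; `-- Targets`: none.
No landed `Negative/` lemma concerns `Ĝ`, `D` or the Combes–Thomas step.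

CHEAPEST FALSIFIER OF STUB M — RUN (kit j021969, this seat, 2026-08-17; details in `Lines/optical_theorem_memory.md`): at `(1,1,1,1,1)`,
`N = 8/16/32`, the exact numerical-range distance `dist(0, W(D(ω)))` of `D = min(|ω|,1)·T·Ĝ_N(ω)⁻¹` is positive for all `ω ∈ [0.05, 6]`, minimal
INSIDE the dressed band (`ω ≈ 2.13`) at `0.0235 / 0.0186 / 0.0174` (saturating), exactly `0` for the harmonic chain on the whole band; `D` is
tridiagonal + a short-range tail identical at `N = 16, 32`; `|Ĝ_{0N}(ω)| ~ e^{−θ'N}` with `θ' = 0.08–0.16`/site across the band. STUB M passes.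
-/

noncomputable section

open MeasureTheory Set Filter Topology

namespace Summit.AtomisticToContinuum.FouriersLaw.Cruxes.CoherentDephasing.OpticalTheoremMemory

open Literature.MathematicalPhysics.KineticTheory.HeatConduction (pinnedChain PhaseSpace)
open Summit.AtomisticToContinuum.FouriersLaw.Theses.PhononMeanFreePath (CoherentDephasing)
open Summit.AtomisticToContinuum.FouriersLaw.Theorems.PhononMeanFreePath

variable (ω₂ lam β γ T : ℝ)

/-- MOMENTUM RESPONSE MATRIX `M_{xy}(t) = ⟨p_x, K_t p_y⟩_{μ_T}` of the `(N+1)`-site chain (Gibbs- and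
noise-averaged response of `p_y` at time `t` to a kick on `p_x`; `respMat … N 0 (Fin.last N) = pairCorr … N` holds by `rfl`,
which is how `CoherentDephasing_of` reads STUB P against the crux). [folklore] -/
def respMat (N : ℕ) (x y : Fin (N + 1)) (t : ℝ) : ℝ :=
  ∫ z, z.2 x * (∫ w, w.2 y ∂((pinnedChain ω₂ lam β γ).transitionKernel (N + 1) T T t.toNNReal z))
    ∂((pinnedChain ω₂ lam β γ).gibbsMeasure (N + 1) T)

/-- FREQUENCY-RESOLVED MOBILITY MATRIX `Ĝ_N(ω)_{xy} = ∫₀^∞ e^{-iωt} M_{xy}(t) dt` (boundary value on the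
imaginary axis of the Laplace transform of the causal momentum response; at fixed `N` the integral converges
absolutely by the exponential decorrelation of the finite open chain). [folklore] -/
def respHat (N : ℕ) (ω : ℝ) : Matrix (Fin (N + 1)) (Fin (N + 1)) ℂ := fun x y =>
  ∫ t in Ioi (0 : ℝ), Complex.exp (-(Complex.I * ((ω * t : ℝ) : ℂ))) * ((respMat ω₂ lam β γ T N x y t : ℝ) : ℂ)

/-- DRIFT OF THE LAST MOMENTUM `(L p_N)(q,p) = -U'(q_N) - V'(q_N - q_{N-1}) - γ p_N` for `pinnedChain`
(`U'(q) = ω₂ q + lam q³`, `V'(r) = r + β r³`; for `N = 0` the bond term vanishes identically). By Dynkin's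
formula `ṙ_N(t) = kickResp … N (lastDrift … N) t` for `N ≥ 1`. [folklore] -/
def lastDrift (N : ℕ) : PhaseSpace (N + 1) → ℝ := fun y =>
  -(ω₂ * y.1 (Fin.last N) + lam * y.1 (Fin.last N) ^ 3) -
    ((y.1 (Fin.last N) - y.1 ⟨N - 1, by omega⟩) + β * (y.1 (Fin.last N) - y.1 ⟨N - 1, by omega⟩) ^ 3) -
    γ * y.2 (Fin.last N)

/-! ## Stubs -/

/-- STUB P (fixed `N`; Plancherel on `L¹ ∩ L²` + Fourier transform of the time derivative; M/L).
**Parseval with a high-frequency remainder.** For `N ≥ 1` and every cut-off `Ω > 0`: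
`∫₀^∞ r_N² ≤ ∫_{[-Ω,Ω]} |Ĝ_N(ω)_{0N}|² dω + Ω⁻² ∫₀^∞ (kickResp (L p_N))²`
(`∫₀^∞ r_N² = (2π)⁻¹ ∫_ℝ |r̂_N|²`, `iω r̂_N(ω) = FT(ṙ_N)` since `r_N(0) = ⟨p₀ p_N⟩_{μ_T} = 0`, `ṙ_N = kickResp (L p_N)` by
Dynkin, Plancherel again; constants `(2π)⁻¹ ≤ 1` dropped). [folklore] -/
theorem stub_parsevalWindow :
    ∀ ω₂ lam β γ : ℝ, 0 < ω₂ → 0 < lam → 0 < β → 0 < γ → ∀ T : ℝ, 0 < T → ∀ N : ℕ, 1 ≤ N → ∀ Ω : ℝ, 0 < Ω →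
      ∫ t in Ioi (0 : ℝ), pairCorr ω₂ lam β γ T N t ^ 2 ≤
        (∫ ω in Icc (-Ω) Ω, ‖respHat ω₂ lam β γ T N ω 0 (Fin.last N)‖ ^ 2) +
          (Ω ^ 2)⁻¹ * ∫ t in Ioi (0 : ℝ), kickResp ω₂ lam β γ T N (lastDrift ω₂ lam β γ N) t ^ 2 := by
  sorry

/-- STUB H (`N`-UNIFORM, ABSOLUTE; landed Landauer/dissipation inequality `kickResp_sq_integral_le` applied to
`g = L p_N` + `N`-uniform Gibbs moments; M). **The time-derivative of the response has `N`-uniformly bounded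
energy**: `∫₀^∞ ṙ_N² = ∫₀^∞ (kickResp (L p_N))² ≤ C₁(ω₂, lam, β, γ, T)` for every `N`. [folklore] -/
theorem stub_derivativeLandauer :
    ∀ ω₂ lam β γ : ℝ, 0 < ω₂ → 0 < lam → 0 < β → 0 < γ → ∀ T : ℝ, 0 < T →
      ∃ C₁ : ℝ, ∀ N : ℕ,
        IntegrableOn (fun t : ℝ => kickResp ω₂ lam β γ T N (lastDrift ω₂ lam β γ N) t ^ 2) (Ioi 0) ∧
          ∫ t in Ioi (0 : ℝ), kickResp ω₂ lam β γ T N (lastDrift ω₂ lam β γ N) t ^ 2 ≤ C₁ := by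
  sorry

/-- STUB M (`N`-UNIFORM, the line's load-bearing statement). **Sectorial margin and quasi-locality of the
rescaled inverse mobility.** There are `κ, θ, C > 0` and `N₀` such that for every `N ≥ N₀` and almost every
frequency `ω`, the mobility matrix factors as `Ĝ_N(ω) = (min |ω| 1 · T) · D⁻¹` with a matrix `D` (the rescaled
Mori inverse mobility `min(|ω|,1)·(iω + Φ_eff/(iω) + Γ + K̂(iω))`) whose numerical range stays at distance `κ`
from `0` (`κ‖u‖² ≤ |⟨u, D u⟩|`) and whose off-diagonal entries decay like `C e^{-θ|x-y|}`, with constants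
independent of `N` and `ω`. At `lam = β = 0` (`K̂ ≡ 0`) the margin fails inside the phonon band: this is where
anharmonicity (bulk absorption `Re K̂ ≥ κ`, the "optical theorem") is used. [difficulty: XL] -/
theorem stub_moriSectorialMargin :
    ∀ ω₂ lam β γ : ℝ, 0 < ω₂ → 0 < lam → 0 < β → 0 < γ → ∀ T : ℝ, 0 < T →
      ∃ κ θ C : ℝ, 0 < κ ∧ 0 < θ ∧ 0 < C ∧ ∃ N₀ : ℕ, ∀ N : ℕ, N₀ ≤ N →
        ∀ᵐ ω : ℝ, ∃ D : Matrix (Fin (N + 1)) (Fin (N + 1)) ℂ,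
          (∀ u : Fin (N + 1) → ℂ, κ * ∑ i, ‖u i‖ ^ 2 ≤ ‖∑ i, (starRingEnd ℂ) (u i) * D.mulVec u i‖) ∧
          (∀ i j : Fin (N + 1), i ≠ j → ‖D i j‖ ≤ C * Real.exp (-θ * |(i : ℝ) - (j : ℝ)|)) ∧
          respHat ω₂ lam β γ T N ω = (((min |ω| 1) * T : ℝ) : ℂ) • D⁻¹ := by
  sorry

/-- STUB CT (abstract finite-dimensional linear algebra; M/L). **Combes–Thomas estimate for matrices with a
sectorial margin and exponentially decaying off-diagonal entries**: the inverse decays exponentially away from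
the diagonal, with constants depending only on `(κ, θ, C)` and not on the size. [folklore] -/
theorem stub_combesThomas :
    ∀ κ θ C : ℝ, 0 < κ → 0 < θ → 0 < C → ∃ A θ' : ℝ, 0 < A ∧ 0 < θ' ∧
      ∀ (n : ℕ) (D : Matrix (Fin n) (Fin n) ℂ),
        (∀ u : Fin n → ℂ, κ * ∑ i, ‖u i‖ ^ 2 ≤ ‖∑ i, (starRingEnd ℂ) (u i) * D.mulVec u i‖) →
        (∀ i j : Fin n, i ≠ j → ‖D i j‖ ≤ C * Real.exp (-θ * |(i : ℝ) - (j : ℝ)|)) →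
        ∀ i j : Fin n, ‖D⁻¹ i j‖ ≤ A * Real.exp (-θ' * |(i : ℝ) - (j : ℝ)|) := by
  sorry

/-! ## The crux from the stubs -/

/-- **Assembly.** `CoherentDephasing` (the route decl, by name) from the four stubs: clause (I) is the landed
`pairCorr_sq_integrableOn`; for (L), STUB M + STUB CT give `|Ĝ_N(ω)_{0N}| ≤ T A e^{-θ'N}` for a.e. `ω` and `N ≥ N₀`, hence
`∫_{[-N,N]} |Ĝ_{0N}|² ≤ 2N T²A² e^{-2θ'N}`; STUB P with `Ω = N` and STUB H bound `∫₀^∞ r_N²` by that plus `C₁/N²`; so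
`0 ≤ N ∫₀^∞ r_N² ≤ 2T²A² N² e^{-2θ'N} + C₁/N → 0`. Pure real analysis; no sorry outside the stubs. -/
theorem CoherentDephasing_of : CoherentDephasing := by
  intro ω₂ lam β γ hω hl hβ hγ T hT
  refine ⟨fun N => Summit.AtomisticToContinuum.FouriersLaw.Theorems.CoherentDephasing.pairCorr_sq_integrableOn
    hω hl.le hβ hγ hT N, ?_⟩
  obtain ⟨C₁, hC₁⟩ := stub_derivativeLandauer ω₂ lam β γ hω hl hβ hγ T hT
  obtain ⟨κ, θ, C, hκ, hθ, hC, N₀, hM⟩ := stub_moriSectorialMargin ω₂ lam β γ hω hl hβ hγ T hT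
  obtain ⟨A, θ', hA, hθ', hCT⟩ := stub_combesThomas κ θ C hκ hθ hC
  -- Step 1: a.e. exponential extinction of the frequency-resolved transmission amplitude
  have hext : ∀ N : ℕ, N₀ ≤ N → ∀ᵐ ω : ℝ,
      ‖respHat ω₂ lam β γ T N ω 0 (Fin.last N)‖ ^ 2 ≤ (T * A * Real.exp (-θ' * N)) ^ 2 := by
    intro N hN
    filter_upwards [hM N hN] with ω hω'
    obtain ⟨D, hmar, hdec, hfac⟩ := hω'
    have h1 := hCT (N + 1) D hmar hdec 0 (Fin.last N)
    have h2 : ‖respHat ω₂ lam β γ T N ω 0 (Fin.last N)‖ ≤ T * A * Real.exp (-θ' * N) := by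
      rw [hfac, Matrix.smul_apply, smul_eq_mul, norm_mul, Complex.norm_real]
      have hs0 : 0 ≤ min |ω| 1 := le_min (abs_nonneg ω) zero_le_one
      have hs1 : min |ω| 1 ≤ 1 := min_le_right _ _
      have habs : ‖(min |ω| 1) * T‖ ≤ T := by
        rw [Real.norm_eq_abs, abs_mul, abs_of_nonneg hs0, abs_of_pos hT]
        calc min |ω| 1 * T ≤ 1 * T := mul_le_mul_of_nonneg_right hs1 hT.le
          _ = T := one_mul T
      have hij : |((0 : Fin (N + 1)) : ℝ) - ((Fin.last N : Fin (N + 1)) : ℝ)| = N := by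
        simp [Fin.val_last]
      rw [hij] at h1
      calc ‖min |ω| 1 * T‖ * ‖D⁻¹ 0 (Fin.last N)‖
          ≤ T * (A * Real.exp (-θ' * N)) :=
            mul_le_mul habs h1 (norm_nonneg _) hT.le
        _ = T * A * Real.exp (-θ' * N) := by ring
    have h0 : 0 ≤ ‖respHat ω₂ lam β γ T N ω 0 (Fin.last N)‖ := norm_nonneg _
    exact pow_le_pow_left₀ h0 h2 2
  -- Step 2: the frequency window `[-N, N]`
  have hwin : ∀ N : ℕ, N₀ ≤ N →
      ∫ ω in Icc (-(N : ℝ)) N, ‖respHat ω₂ lam β γ T N ω 0 (Fin.last N)‖ ^ 2 ≤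
        (T * A * Real.exp (-θ' * N)) ^ 2 * (2 * N) := by
    intro N hN
    have hle := hext N hN
    have hconst : IntegrableOn (fun _ : ℝ => (T * A * Real.exp (-θ' * N)) ^ 2) (Icc (-(N : ℝ)) N) volume :=
      integrableOn_const (hs := by rw [Real.volume_Icc]; exact ENNReal.ofReal_ne_top) (hC := enorm_ne_top)
    calc ∫ ω in Icc (-(N : ℝ)) N, ‖respHat ω₂ lam β γ T N ω 0 (Fin.last N)‖ ^ 2
        ≤ ∫ ω in Icc (-(N : ℝ)) N, (T * A * Real.exp (-θ' * N)) ^ 2 :=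
          integral_mono_of_nonneg (Eventually.of_forall fun ω => by positivity) hconst
            (ae_restrict_of_ae hle)
      _ = (T * A * Real.exp (-θ' * N)) ^ 2 * (2 * N) := by
          rw [setIntegral_const, measureReal_def, Real.volume_Icc, smul_eq_mul]
          have h2N : (N : ℝ) - -(N : ℝ) = 2 * N := by ring
          rw [h2N, ENNReal.toReal_ofReal (by positivity)]
          ring
  -- Step 3: Parseval with cut-off Ω = N, and the N-uniform derivative bound
  have hmain : ∀ N : ℕ, max N₀ 1 ≤ N →
      (N : ℝ) * ∫ t in Ioi (0 : ℝ), pairCorr ω₂ lam β γ T N t ^ 2 ≤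
        2 * (T * A) ^ 2 * ((N : ℝ) ^ 2 * Real.exp (-(2 * θ') * N)) + C₁ / N := by
    intro N hN
    have hN₀ : N₀ ≤ N := le_trans (le_max_left _ _) hN
    have hN1 : 1 ≤ N := le_trans (le_max_right _ _) hN
    have hNpos : (0 : ℝ) < N := by exact_mod_cast hN1
    have hP := stub_parsevalWindow ω₂ lam β γ hω hl hβ hγ T hT N hN1 N hNpos
    have hW := hwin N hN₀
    have hH := (hC₁ N).2
    have hexp : Real.exp (-θ' * N) ^ 2 = Real.exp (-(2 * θ') * N) := by
      rw [← Real.exp_nat_mul]; congr 1; push_cast; ring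
    calc (N : ℝ) * ∫ t in Ioi (0 : ℝ), pairCorr ω₂ lam β γ T N t ^ 2
        ≤ (N : ℝ) * ((T * A * Real.exp (-θ' * N)) ^ 2 * (2 * N) + ((N : ℝ) ^ 2)⁻¹ * C₁) := by
          refine mul_le_mul_of_nonneg_left (hP.trans (add_le_add hW ?_)) hNpos.le
          exact mul_le_mul_of_nonneg_left hH (by positivity)
      _ = 2 * (T * A) ^ 2 * ((N : ℝ) ^ 2 * Real.exp (-(2 * θ') * N)) + C₁ / N := by
          rw [← hexp]; field_simp
  -- Step 4: squeeze
  have hlim1 : Tendsto (fun N : ℕ => (N : ℝ) ^ 2 * Real.exp (-(2 * θ') * N)) atTop (𝓝 0) := by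
    have hc : (0 : ℝ) < 2 * θ' := by positivity
    have h := (Real.tendsto_pow_mul_exp_neg_atTop_nhds_zero 2).comp
      ((tendsto_natCast_atTop_atTop (R := ℝ)).const_mul_atTop hc)
    have h' := h.const_mul ((2 * θ') ^ 2)⁻¹
    rw [mul_zero] at h'
    refine h'.congr fun N => ?_
    simp only [Function.comp_apply]
    field_simp
  have hlim2 : Tendsto (fun N : ℕ => C₁ / (N : ℝ)) atTop (𝓝 0) := tendsto_const_div_atTop_nhds_zero_nat C₁
  have hlim : Tendsto (fun N : ℕ => 2 * (T * A) ^ 2 * ((N : ℝ) ^ 2 * Real.exp (-(2 * θ') * N)) + C₁ / N)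
      atTop (𝓝 0) := by
    have := (hlim1.const_mul (2 * (T * A) ^ 2)).add hlim2
    simpa using this
  change Tendsto (fun N : ℕ => (N : ℝ) * ∫ t in Ioi (0 : ℝ), pairCorr ω₂ lam β γ T N t ^ 2) atTop (𝓝 0)
  refine squeeze_zero' (Eventually.of_forall fun N => mul_nonneg (Nat.cast_nonneg N)
    (setIntegral_nonneg measurableSet_Ioi fun t _ => sq_nonneg _)) ?_ hlim
  filter_upwards [eventually_ge_atTop (max N₀ 1)] with N hN
  exact hmain N hN

end Summit.AtomisticToContinuum.FouriersLaw.Cruxes.CoherentDephasing.OpticalTheoremMemory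

end
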